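import Literature.AnabelianGeometry.AbsoluteAnabelian.UnitKummerNaturalityColimit
import Literature.AnabelianGeometry.AbsoluteAnabelian.UnitKummerTransport
import Literature.AnabelianGeometry.AbsoluteAnabelian.MLFGaloisGroupification
import Literature.AnabelianGeometry.EtaleTheta.KummerFunctorialityCovariantIso
import HarnessLib

/-!
# [AbsTopIII] Prop 3.3 (i) on ABSTRACT MLF-Galois `TCG`-pairs: naturality and canonicity of the transported unit
# Kummer theory, with the INTRINSIC coefficients `μ_Ẑ(𝒪_k̄^×) = Λ((𝒪_k̄^×)ˣ)`

S. Mochizuki, *Topics in absolute anabelian geometry III*, §3, Prop. 3.3 (i) p. 73 (bib key `MochizukiAbsTopIII2015`): for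
`T = TCG` the pair is `(Π ↷ M) ≅ (Π_k ↷ 𝒪_k̄^×)` and the Kummer maps `M^H → H¹(H, μ_Ẑ(M))` are functorial relative to
`C^MLF_TCG` (morphisms of Def. 3.1 (ii) p. 67).

abc-iut cell, layer L4, row «Prop33i-ABSTRACT-PAIR (b)(c) TWIN», file B (seat abc-iut-w4-d009 gen 4): the `TCG` twin of
`UnitKummerTransportCanonical.lean` (file A, `TLG`) and of abc-iut-L4-t2's `MonoidKummerTransportCanonical.lean` (`TM`).
Because the unit map `φ_M : 𝒪_{k̄₁}^× → 𝒪_{k̄₂}^×` of a `TCG` morphism has no canonical extension to `k̄ˣ`, the natural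
coefficients are the intrinsic ones, `Λ((𝒪_k̄^×)ˣ)` (`UnitKummerNaturalityTCGIntrinsic.lean`, p430251: the two instances
`Π_k ↷ (𝒪_k̄^×)ˣ`, `RootableBy (𝒪_k̄^×)ˣ ℕ`); abc-iut-L4-t2's transported `TCG` theory has carriers `H¹(e⁻¹H, Λ(k̄ˣ))`, reached
from the intrinsic classes through the comparison square along `(𝒪_k̄^×)ˣ ↪ k̄ˣ` (`unitKummerTheoryTCG_kummer_eq_push_intrinsic`),
BOTH legs of which are isomorphisms (`isIso_pushH1_incl` below: `Λ(incl)` is abc-iut-L4-t2's bijection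
`cyclotomeSubmonoidHom_bijective`, although `incl` itself is not surjective — whence the variant `isIso_pushH1_of_cyclotome_bijective`).

* `MLFClosure.unitSubmonoidToUnits` — every element of the monoid `𝒪_k̄^×` is a unit of it (`𝒪_k̄^× →* (𝒪_k̄^×)ˣ`, identity on
  carriers);
* `GaloisMonoidPair.TCGPresentation P` {C, D, iso : Iso D.tcgPair P} (`nonempty_iff ↔ IsMLFGaloisMonoidPair .TCG P`),
  `TCGPresentation.unitKummerTheory π := (model TCG theory).transport e` (+ `_kummer`, rfl);
* (b) **`TCGPresentation.kummer_natural_intrinsic`** — for a Def. 3.1 (ii) morphism `f : P → Q` of abstract `TCG`-pairs with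
  presentations `π`, `ϖ`: `pull (κ^int_{e'⁻¹H'}(e'⁻¹ f_M m)) = push (κ^int_{e⁻¹H}(e⁻¹ m))` along the intrinsic transition morphism
  `(e'⁻¹ f_Π e, ((e'⁻¹ f_M e))ˣ)`, and **`TCGPresentation.kummer_eq_push_intrinsic`** — the transported classes
  `π.unitKummerTheory.kummer H m` are the intrinsic ones through the comparison square;
* (c) **`TCGPresentation.canonicalIsoIntrinsic π₁ π₂ H`** + **`canonicalIsoIntrinsic_kummerClass`** — two presentations of the
  SAME pair: the comparison isomorphism of `e₂⁻¹e₁` on `H¹(eᵢ⁻¹H, Λ((𝒪_{k̄ᵢ}^×)ˣ))` carries `κ^int(e₁⁻¹m)` to `κ^int(e₂⁻¹m)`;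
* `EquivariantMorphism.isIso_pushH1_of_cyclotome_bijective` (variant of abc-iut-L4-t2's `isIso_pushH1`) and
  `ModelMLFGaloisData.isIso_pushH1_incl` / `isIso_pullH1_incl` — both legs of the `Λ(k̄ˣ)`-comparison square are isomorphisms,
  so the canonicity transfers to abc-iut-L4-t2's carriers.

HONEST FRAMING: classical Kummer theory at OUR model objects; theories obtained from models; nothing here bears on
[IUTchIII] Cor. 3.12; no side taken.
-/

noncomputable section

namespace Literature.AnabelianGeometry.EtaleTheta

open groupCohomology CategoryTheory

namespace EquivariantMorphism

variable {G₁ A₁ G₂ A₂ : Type} [Group G₁] [CommGroup A₁] [MulDistribMulAction G₁ A₁]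
  [Group G₂] [CommGroup A₂] [MulDistribMulAction G₂ A₂] (c : EquivariantMorphism G₁ A₁ G₂ A₂)
  {H₁ : Subgroup G₁} {H₂ : Subgroup G₂} (hH : H₁.map c.groupHom ≤ H₂)

/-- **`push` is an isomorphism as soon as `Λ(ψ) : Λ(A₁) → Λ(A₂)` is bijective** (variant of abc-iut-L4-t2's
`isIso_pushH1`, which assumes `ψ` itself bijective; needed for `ψ = ((𝒪_k̄^×)ˣ ↪ k̄ˣ)`, not surjective but bijective on
compatible systems of roots of unity). [cite: MochizukiAbsTopIII2015, Definition 3.1 (ii) p.67] -/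
theorem isIso_pushH1_of_cyclotome_bijective (hΛ : Function.Bijective (cyclotome.map c.map)) : IsIso (c.pushH1 hH) := by
  let e' : (cyclotomeRep (A := A₁) H₁).V ≃ₗ[ℤ] (c.resRep hH).V :=
    LinearEquiv.ofBijective (c.cyclotomeHom hH).hom.toLinearMap hΛ
  let I : H1 (cyclotomeRep (A := A₁) H₁) ≅ H1 (c.resRep hH) :=
    groupCohomology.mapIso (A := c.resRep hH) (B := cyclotomeRep (A := A₁) H₁) (MulEquiv.refl H₁)
      e' (fun g => by
        ext v
        exact c.cyclotome_map_smul (g : G₁) (Additive.toMul v)) 1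
  have hI : I.hom = c.pushH1 hH := by
    change groupCohomology.map _ _ 1 = groupCohomology.map _ _ 1
    refine groupCohomology.map_congr ?_ ?_ 1
    · exact MonoidHom.ext fun x => rfl
    · exact LinearMap.ext fun _ => rfl
  rw [← hI]
  infer_instance

end EquivariantMorphism

end Literature.AnabelianGeometry.EtaleTheta

namespace Literature.AnabelianGeometry.AbsoluteAnabelian

open _root_.CategoryTheory
open Literature.AnabelianGeometry.EtaleTheta (kummerClass invariants cyclotomeRep EquivariantMorphism)

universe u

/-! ### Every element of `𝒪_k̄^×` is a unit of that monoid -/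

namespace MLFClosure

variable (C : MLFClosure.{u})

/-- The inverse in `𝒪_k̄` of an element of `𝒪_k̄^×` (chosen from the defining existential). [cite: MochizukiAbsTopIII2015, Definition 3.1 (i) p.66] -/
theorem exists_inv_mem (x : unitSubmonoid C.k C.K) :
    ∃ y : C.K, y ∈ unitSubmonoid C.k C.K ∧ (x : C.K) * y = 1 := by
  obtain ⟨hx, y, hy, hxy⟩ := x.2
  exact ⟨y, ⟨hy, (x : C.K), hx, by rw [mul_comm]; exact hxy⟩, hxy⟩

/-- **`𝒪_k̄^× →* (𝒪_k̄^×)ˣ`**: every element of the monoid `𝒪_k̄^×` is a unit of it (identity on carriers).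
[cite: MochizukiAbsTopIII2015, Definition 3.1 (i) p.66] -/
def unitSubmonoidToUnits : unitSubmonoid C.k C.K →* (unitSubmonoid C.k C.K)ˣ where
  toFun x := ⟨x, ⟨Classical.choose (C.exists_inv_mem x), (Classical.choose_spec (C.exists_inv_mem x)).1⟩,
    Subtype.ext (Classical.choose_spec (C.exists_inv_mem x)).2,
    Subtype.ext (by rw [Submonoid.coe_mul, mul_comm]; exact (Classical.choose_spec (C.exists_inv_mem x)).2)⟩
  map_one' := Units.ext rfl
  map_mul' _ _ := Units.ext rfl

/-- `unitSubmonoidToUnits` is the identity on carriers. [cite: MochizukiAbsTopIII2015, Definition 3.1 (i) p.66] -/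
@[simp] theorem coe_unitSubmonoidToUnits (x : unitSubmonoid C.k C.K) :
    ((C.unitSubmonoidToUnits x : (unitSubmonoid C.k C.K)ˣ) : unitSubmonoid C.k C.K) = x := rfl

end MLFClosure

/-! ### Both legs of the `Λ(k̄ˣ)`-comparison square are isomorphisms -/

namespace ModelMLFGaloisData

variable (C : MLFClosure.{0}) (D : ModelMLFGaloisData C.k C.K)

/-- The inclusion `(𝒪_k̄^×)ˣ ↪ k̄ˣ` as an equivariant morphism over `id_{Π_k}`. [cite: MochizukiAbsTopIII2015, Definition 3.1 (i) p.67] -/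
abbrev inclMorphism : EquivariantMorphism D.Pi (unitSubmonoid C.k C.K)ˣ D.Pi (C.K)ˣ :=
  ⟨MonoidHom.id D.Pi, Units.map (unitSubmonoid C.k C.K).subtype, D.unitsMap_subtype_smul C⟩

/-- The push-forward along `Λ((𝒪_k̄^×)ˣ ↪ k̄ˣ)` is an isomorphism (`Λ(incl)` = abc-iut-L4-t2's bijection
`cyclotomeSubmonoidHom_bijective`: every root of unity of `k̄` is a unit of `𝒪_k̄`). [cite: MochizukiAbsTopIII2015, Definition 3.1 (v) p.69] -/
theorem isIso_pushH1_incl (H : OpenSubgroup D.tcgPair.Pi) :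
    IsIso ((D.inclMorphism C).pushH1 (H₁ := (H : Subgroup D.Pi)) (H₂ := (H : Subgroup D.Pi)) (Subgroup.map_id _).le) :=
  (D.inclMorphism C).isIso_pushH1_of_cyclotome_bijective _
    (C.cyclotomeSubmonoidHom_bijective _ C.mem_unitSubmonoid_of_pow_eq_one')

/-- The pull-back leg (along `id`) of the comparison square is an isomorphism. [cite: MochizukiAbsTopIII2015, Definition 3.1 (i) p.67] -/
theorem isIso_pullH1_incl (H : OpenSubgroup D.tcgPair.Pi) :
    IsIso ((D.inclMorphism C).pullH1 (H₁ := (H : Subgroup D.Pi)) (H₂ := (H : Subgroup D.Pi)) (Subgroup.map_id _).le) :=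
  (D.inclMorphism C).isIso_pullH1 _ ⟨fun _ _ h => Subtype.ext (congrArg Subtype.val h), fun y => ⟨⟨y.1, y.2⟩, rfl⟩⟩

end ModelMLFGaloisData

/-! ### `TCG` presentations of an abstract pair and their unit Kummer theories -/

namespace GaloisMonoidPair

/-- A **`TCG` model presentation** of an abstract pair `P = (Π ↷ M)`: model data (Def. 3.1 (i)) with an isomorphism of pairs
`e : (Π_k ↷ 𝒪_k̄^×) ⥲ (Π ↷ M)` (Def. 3.1 (ii)). [cite: MochizukiAbsTopIII2015, Definition 3.1 (ii) p.67] -/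
structure TCGPresentation (P : GaloisMonoidPair.{u}) : Type (u + 1) where
  /-- the MLF `k` with an algebraic closure `k̄` -/
  C : MLFClosure.{u}
  /-- the model data `ε_k : Π_k ↠ G_k` -/
  D : ModelMLFGaloisData C.k C.K
  /-- the isomorphism of pairs `(Π_k ↷ 𝒪_k̄^×) ⥲ P` -/
  iso : GaloisMonoidPair.Iso D.tcgPair P

namespace TCGPresentation

section General

variable {P Q : GaloisMonoidPair.{u}}

/-- A pair admits a `TCG` presentation iff it is an MLF-Galois `TCG`-pair. [cite: MochizukiAbsTopIII2015, Definition 3.1 (ii) p.67] -/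
theorem nonempty_iff : Nonempty P.TCGPresentation ↔ IsMLFGaloisMonoidPair .TCG P := by
  constructor
  · rintro ⟨π⟩
    exact ⟨⟨π.C, π.D, π.D.tcgPair, π.D.monoidPair_TCG, ⟨π.iso⟩⟩⟩
  · intro hP
    obtain ⟨C, D, Q₀, hQ₀, ⟨e⟩⟩ := hP.exists_model
    have hQ' : D.tcgPair = Q₀ := Option.some_injective _ (D.monoidPair_TCG.symm.trans hQ₀)
    subst hQ'
    exact ⟨⟨C, D, e⟩⟩

/-- The open subgroup `e⁻¹(H) ⊆ Π_k` of the model under a presentation. [cite: MochizukiAbsTopIII2015, Definition 3.1 (ii) p.67] -/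
abbrev comapOpen (π : P.TCGPresentation) (H : OpenSubgroup P.Pi) : OpenSubgroup π.D.tcgPair.Pi :=
  H.comap π.iso.isoPi.toMonoidHom π.iso.isoPi.continuous

/-- The unit of `𝒪_k̄^×` corresponding to `m ∈ M` under a presentation: `(e⁻¹ m)ˣ`. [cite: MochizukiAbsTopIII2015, Definition 3.1 (ii) p.67] -/
abbrev unitOf (π : P.TCGPresentation) (m : P.M) : (unitSubmonoid π.C.k π.C.K)ˣ :=
  π.C.unitSubmonoidToUnits (π.iso.isoM.symm m)

/-- `(e⁻¹ m)ˣ` is `e⁻¹H`-invariant when `m` is `H`-invariant. [cite: MochizukiAbsTopIII2015, Definition 3.1 (ii) p.67] -/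
theorem unitOf_smul (π : P.TCGPresentation) {H : OpenSubgroup P.Pi} {m : P.M} (hm : ∀ h : H, (h : P.Pi) • m = m)
    (g : π.comapOpen H) : (g : π.D.Pi) • π.unitOf m = π.unitOf m :=
  Units.ext (π.iso.smul_symm_eq_of_mem_comap hm g)

end General

section UnitKummerTheory

variable {P : GaloisMonoidPair.{0}}

/-- **The unit Kummer theory of a `TCG` presentation**: abc-iut-L4-t2's model theory `unitKummerTheoryTCG` transported along `e`
(the theory of `exists_unitKummerTheory_TCG_injective`); its `H¹(H)` is `H¹(e⁻¹H, Λ(k̄ˣ))`. [cite: MochizukiAbsTopIII2015, Proposition 3.3 (i) p.73] -/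
def unitKummerTheory (π : P.TCGPresentation) : UnitKummerTheory .TCG P :=
  (π.D.unitKummerTheoryTCG π.C).transport π.iso

/-- The Kummer map of `π.unitKummerTheory` at `H`, unfolded. [cite: MochizukiAbsTopIII2015, Proposition 3.3 (i) p.73] -/
theorem unitKummerTheory_kummer (π : P.TCGPresentation) (H : OpenSubgroup P.Pi)
    (m : {m : P.M // ∀ h : H, (h : P.Pi) • m = m}) :
    π.unitKummerTheory.kummer H m = (π.D.unitKummerTheoryTCG π.C).kummer (π.comapOpen H)
      ⟨π.iso.isoM.symm m.1, fun g => π.iso.smul_symm_eq_of_mem_comap m.2 g⟩ :=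
  rfl

/-- **The transported classes are the intrinsic ones through the comparison square**: for `m ∈ M^H`, in
`H¹(e⁻¹H, res_id Λ(k̄ˣ))`, `pull_id (π.unitKummerTheory.kummer H m) = push_incl (κ^int_{e⁻¹H}((e⁻¹m)ˣ))` — both legs isomorphisms
(`isIso_pullH1_incl`, `isIso_pushH1_incl`). [cite: MochizukiAbsTopIII2015, Proposition 3.3 (i) p.73] -/
theorem kummer_eq_push_intrinsic (π : P.TCGPresentation) (H : OpenSubgroup P.Pi)
    (m : {m : P.M // ∀ h : H, (h : P.Pi) • m = m}) :
    (π.D.inclMorphism π.C).pullH1 (Subgroup.map_id _).le (π.unitKummerTheory.kummer H m) =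
      (π.D.inclMorphism π.C).pushH1 (Subgroup.map_id _).le
        (kummerClass ((π.comapOpen H : OpenSubgroup π.D.tcgPair.Pi) : Subgroup π.D.Pi)
          (⟨π.unitOf m.1, π.unitOf_smul m.2⟩ :
            invariants (A := (unitSubmonoid π.C.k π.C.K)ˣ) ((π.comapOpen H : OpenSubgroup π.D.tcgPair.Pi) : Subgroup π.D.Pi))) :=
  π.D.unitKummerTheoryTCG_kummer_eq_push_intrinsic π.C (π.comapOpen H) ⟨π.unitOf m.1, π.unitOf_smul m.2⟩

end UnitKummerTheory

/-! ### (b) Naturality of the unit Kummer maps on abstract `TCG`-pairs (intrinsic coefficients) -/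

section Natural

variable {P Q : GaloisMonoidPair.{0}} (f : GaloisMonoidPair.Hom P Q) (π : P.TCGPresentation) (ϖ : Q.TCGPresentation)

/-- The transition homomorphism `e'⁻¹ ∘ f_Π ∘ e` on the groups. [cite: MochizukiAbsTopIII2015, Definition 3.1 (ii) p.67] -/
def transitionPi : π.D.Pi →* ϖ.D.Pi :=
  (ϖ.iso.isoPi.symm.toMonoidHom.comp f.homPi).comp π.iso.isoPi.toMonoidHom

/-- The transition homomorphism `e'⁻¹ ∘ f_M ∘ e : 𝒪_{k̄}^× → 𝒪_{k̄'}^×`. [cite: MochizukiAbsTopIII2015, Definition 3.1 (ii) p.67] -/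
def transitionM : unitSubmonoid π.C.k π.C.K →* unitSubmonoid ϖ.C.k ϖ.C.K :=
  (ϖ.iso.isoM.symm.toMonoidHom.comp f.homM).comp π.iso.isoM.toMonoidHom

/-- The transition pair is equivariant. [cite: MochizukiAbsTopIII2015, Definition 3.1 (ii) p.67] -/
theorem transition_smul (g : π.D.Pi) (m : unitSubmonoid π.C.k π.C.K) :
    transitionM f π ϖ (g • m) = transitionPi f π ϖ g • transitionM f π ϖ m := by
  change ϖ.iso.symm.isoM (f.homM (π.iso.isoM (g • m))) =
    ϖ.iso.symm.isoPi (f.homPi (π.iso.isoPi g)) • ϖ.iso.symm.isoM (f.homM (π.iso.isoM m))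
  rw [π.iso.smul_comm, f.smul_comm, ϖ.iso.symm.smul_comm]

/-- The INTRINSIC units equivariant morphism `(Π_k ↷ (𝒪_k̄^×)ˣ) → (Π_{k'} ↷ (𝒪_{k̄'}^×)ˣ)` of the transition pair.
[cite: MochizukiAbsTopIII2015, Definition 3.1 (ii) p.67] -/
abbrev transitionMorphism : EquivariantMorphism π.D.Pi (unitSubmonoid π.C.k π.C.K)ˣ ϖ.D.Pi (unitSubmonoid ϖ.C.k ϖ.C.K)ˣ :=
  ⟨transitionPi f π ϖ, Units.map (transitionM f π ϖ), fun g u => Units.ext (transition_smul f π ϖ g (u : unitSubmonoid π.C.k π.C.K))⟩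

/-- `f_Π(H) ⊆ H'` implies `(e'⁻¹ f_Π e)(e⁻¹H) ⊆ e'⁻¹H'`. [cite: MochizukiAbsTopIII2015, Definition 3.1 (ii) p.67] -/
theorem map_transitionPi_le {H : OpenSubgroup P.Pi} {H' : OpenSubgroup Q.Pi}
    (hH : (H : Subgroup P.Pi).map f.homPi ≤ (H' : Subgroup Q.Pi)) :
    ((π.comapOpen H : OpenSubgroup π.D.tcgPair.Pi) : Subgroup π.D.Pi).map (transitionPi f π ϖ) ≤
      ((ϖ.comapOpen H' : OpenSubgroup ϖ.D.tcgPair.Pi) : Subgroup ϖ.D.Pi) := by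
  rintro _ ⟨x, hx, rfl⟩
  change ϖ.iso.isoPi (ϖ.iso.isoPi.symm (f.homPi (π.iso.isoPi x))) ∈ (H' : Subgroup Q.Pi)
  rw [ContinuousMulEquiv.apply_symm_apply]
  exact hH ⟨π.iso.isoPi x, hx, rfl⟩

/-- **[AbsTopIII] Prop 3.3 (i) — naturality of the unit Kummer maps along a morphism of ABSTRACT MLF-Galois `TCG`-pairs,
intrinsic coefficients.**  For a Def. 3.1 (ii) morphism `f : (Π ↷ M) → (Π' ↷ M')` with `TCG` presentations `π = (k, e)`,
`ϖ = (k', e')`, open `H ⊆ Π`, `H' ⊆ Π'` with `f_Π(H) ⊆ H'`, `m ∈ M^H` with `f_M m ∈ M'^{H'}`: in `H¹(e⁻¹H, res Λ((𝒪_{k̄'}^×)ˣ))`,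
`pull (κ^int_{e'⁻¹H'}((e'⁻¹ f_M m)ˣ)) = push (κ^int_{e⁻¹H}((e⁻¹ m)ˣ))` along the intrinsic transition morphism — the transported
classes `π.unitKummerTheory.kummer`, `ϖ.unitKummerTheory.kummer` being these through the comparison squares
(`kummer_eq_push_intrinsic`). [cite: MochizukiAbsTopIII2015, Proposition 3.3 (i) p.73] -/
theorem kummer_natural_intrinsic (H : OpenSubgroup P.Pi) (H' : OpenSubgroup Q.Pi)
    (hH : (H : Subgroup P.Pi).map f.homPi ≤ (H' : Subgroup Q.Pi))
    (m : {m : P.M // ∀ h : H, (h : P.Pi) • m = m})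
    (hm : ∀ h : H', (h : Q.Pi) • f.homM m.1 = f.homM m.1) :
    (transitionMorphism f π ϖ).pullH1 (map_transitionPi_le f π ϖ hH)
        (kummerClass ((ϖ.comapOpen H' : OpenSubgroup ϖ.D.tcgPair.Pi) : Subgroup ϖ.D.Pi)
          (⟨ϖ.unitOf (f.homM m.1), ϖ.unitOf_smul hm⟩ :
            invariants (A := (unitSubmonoid ϖ.C.k ϖ.C.K)ˣ) ((ϖ.comapOpen H' : OpenSubgroup ϖ.D.tcgPair.Pi) : Subgroup ϖ.D.Pi))) =
      (transitionMorphism f π ϖ).pushH1 (map_transitionPi_le f π ϖ hH)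
        (kummerClass ((π.comapOpen H : OpenSubgroup π.D.tcgPair.Pi) : Subgroup π.D.Pi)
          (⟨π.unitOf m.1, π.unitOf_smul m.2⟩ :
            invariants (A := (unitSubmonoid π.C.k π.C.K)ˣ) ((π.comapOpen H : OpenSubgroup π.D.tcgPair.Pi) : Subgroup π.D.Pi))) := by
  refine EquivariantMorphism.pullH1_kummerClass _ _ _ _ (Units.ext (Subtype.ext ?_))
  change (((ϖ.iso.isoM.symm (f.homM (π.iso.isoM (π.iso.isoM.symm m.1))) : unitSubmonoid ϖ.C.k ϖ.C.K)) : ϖ.C.K) =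
    ((ϖ.iso.isoM.symm (f.homM m.1) : unitSubmonoid ϖ.C.k ϖ.C.K) : ϖ.C.K)
  rw [MulEquiv.apply_symm_apply]

end Natural

/-! ### (c) Canonicity: two `TCG` presentations of the same pair (intrinsic carriers) -/

section Canonical

variable {P : GaloisMonoidPair.{0}} (π₁ π₂ : P.TCGPresentation)

/-- The change-of-presentation isomorphism `e₂⁻¹ ∘ e₁` of `TCG` models. [cite: MochizukiAbsTopIII2015, Definition 3.1 (ii) p.67] -/
def changeIso : GaloisMonoidPair.Iso π₁.D.tcgPair π₂.D.tcgPair := π₁.iso.trans π₂.iso.symm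

/-- The INTRINSIC units equivariant morphism of the change of presentation: `(e₂⁻¹e₁, (e₂⁻¹e₁)ˣ)`.
[cite: MochizukiAbsTopIII2015, Definition 3.1 (ii) p.67] -/
abbrev changeMorphism : EquivariantMorphism π₁.D.Pi (unitSubmonoid π₁.C.k π₁.C.K)ˣ π₂.D.Pi (unitSubmonoid π₂.C.k π₂.C.K)ˣ :=
  ⟨(changeIso π₁ π₂).isoPi.toMonoidHom, Units.map (changeIso π₁ π₂).isoM.toMonoidHom,
    fun g u => Units.ext ((changeIso π₁ π₂).smul_comm g (u : unitSubmonoid π₁.C.k π₁.C.K))⟩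

/-- `e₂⁻¹ e₁` maps `e₁⁻¹H` into `e₂⁻¹H`. [cite: MochizukiAbsTopIII2015, Definition 3.1 (ii) p.67] -/
theorem map_changeIso_le (H : OpenSubgroup P.Pi) :
    ((π₁.comapOpen H : OpenSubgroup π₁.D.tcgPair.Pi) : Subgroup π₁.D.Pi).map (changeMorphism π₁ π₂).groupHom ≤
      ((π₂.comapOpen H : OpenSubgroup π₂.D.tcgPair.Pi) : Subgroup π₂.D.Pi) := by
  rintro _ ⟨x, hx, rfl⟩
  change π₂.iso.isoPi (π₂.iso.isoPi.symm (π₁.iso.isoPi x)) ∈ (H : Subgroup P.Pi)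
  rw [ContinuousMulEquiv.apply_symm_apply]
  exact hx

/-- `e₂⁻¹ e₁ : e₁⁻¹H → e₂⁻¹H` is bijective. [cite: MochizukiAbsTopIII2015, Definition 3.1 (ii) p.67] -/
theorem changeIso_restrict_bijective (H : OpenSubgroup P.Pi) :
    Function.Bijective ((changeMorphism π₁ π₂).groupHomRestrict (map_changeIso_le π₁ π₂ H)) := by
  constructor
  · intro x y hxy
    apply Subtype.ext
    have h := congrArg (fun z : π₂.comapOpen H => ((z : π₂.D.Pi))) hxy
    exact (changeIso π₁ π₂).isoPi.injective h
  · intro y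
    refine ⟨⟨(changeIso π₁ π₂).isoPi.symm y, ?_⟩, Subtype.ext ?_⟩
    · change π₁.iso.isoPi ((changeIso π₁ π₂).isoPi.symm y) ∈ (H : Subgroup P.Pi)
      have hy : π₂.iso.isoPi (y : π₂.D.Pi) ∈ (H : Subgroup P.Pi) := y.2
      convert hy using 1
      change π₁.iso.isoPi (π₁.iso.isoPi.symm (π₂.iso.isoPi (y : π₂.D.Pi))) = _
      rw [ContinuousMulEquiv.apply_symm_apply]
    · exact (changeIso π₁ π₂).isoPi.apply_symm_apply y

/-- `((e₂⁻¹e₁))ˣ` is bijective on the unit groups (Mathlib `Units.mapEquiv`). [cite: MochizukiAbsTopIII2015, Definition 3.1 (ii) p.67] -/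
theorem changeMorphism_map_bijective : Function.Bijective (changeMorphism π₁ π₂).map :=
  (Units.mapEquiv (changeIso π₁ π₂).isoM).bijective

/-- **The canonical identification of the INTRINSIC cohomology carriers of two `TCG` presentations**
`H¹(e₁⁻¹H, Λ((𝒪_{k̄₁}^×)ˣ)) ≅ H¹(e₂⁻¹H, Λ((𝒪_{k̄₂}^×)ˣ))` — abc-iut-L4-t2's comparison isomorphism of `e₂⁻¹e₁` (both cospan legs
invertible). [cite: MochizukiAbsTopIII2015, Proposition 3.3 (i) p.73] -/
def canonicalIsoIntrinsic (H : OpenSubgroup P.Pi) :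
    groupCohomology.H1 (cyclotomeRep (A := (unitSubmonoid π₁.C.k π₁.C.K)ˣ)
        ((π₁.comapOpen H : OpenSubgroup π₁.D.tcgPair.Pi) : Subgroup π₁.D.Pi)) ≅
      groupCohomology.H1 (cyclotomeRep (A := (unitSubmonoid π₂.C.k π₂.C.K)ˣ)
        ((π₂.comapOpen H : OpenSubgroup π₂.D.tcgPair.Pi) : Subgroup π₂.D.Pi)) :=
  (changeMorphism π₁ π₂).comparisonIso (map_changeIso_le π₁ π₂ H)
    (changeIso_restrict_bijective π₁ π₂ H) (changeMorphism_map_bijective π₁ π₂)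

/-- **CANONICITY of the transported unit Kummer theory ([AbsTopIII] Prop 3.3 (i) on abstract `TCG`-pairs), intrinsic carriers**:
for two `TCG` presentations of the same pair, every open `H ⊆ Π` and `m ∈ M^H`, the canonical identification carries the
intrinsic Kummer class `κ^int_{e₁⁻¹H}((e₁⁻¹m)ˣ)` to `κ^int_{e₂⁻¹H}((e₂⁻¹m)ˣ)`; abc-iut-L4-t2's `Λ(k̄ˣ)`-carriers are reached from
these by the comparison squares `kummer_eq_push_intrinsic`, whose legs are isomorphisms (`isIso_pullH1_incl`,
`isIso_pushH1_incl`). [cite: MochizukiAbsTopIII2015, Proposition 3.3 (i) p.73] -/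
theorem canonicalIsoIntrinsic_kummerClass (H : OpenSubgroup P.Pi) (m : {m : P.M // ∀ h : H, (h : P.Pi) • m = m}) :
    (canonicalIsoIntrinsic π₁ π₂ H).hom
        (kummerClass ((π₁.comapOpen H : OpenSubgroup π₁.D.tcgPair.Pi) : Subgroup π₁.D.Pi)
          (⟨π₁.unitOf m.1, π₁.unitOf_smul m.2⟩ :
            invariants (A := (unitSubmonoid π₁.C.k π₁.C.K)ˣ) ((π₁.comapOpen H : OpenSubgroup π₁.D.tcgPair.Pi) : Subgroup π₁.D.Pi))) =
      kummerClass ((π₂.comapOpen H : OpenSubgroup π₂.D.tcgPair.Pi) : Subgroup π₂.D.Pi)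
        (⟨π₂.unitOf m.1, π₂.unitOf_smul m.2⟩ :
          invariants (A := (unitSubmonoid π₂.C.k π₂.C.K)ˣ) ((π₂.comapOpen H : OpenSubgroup π₂.D.tcgPair.Pi) : Subgroup π₂.D.Pi)) := by
  refine (changeMorphism π₁ π₂).comparisonIso_kummerClass (map_changeIso_le π₁ π₂ H)
    (changeIso_restrict_bijective π₁ π₂ H) (changeMorphism_map_bijective π₁ π₂) _ _ (Units.ext (Subtype.ext ?_))
  change (((π₂.iso.isoM.symm (π₁.iso.isoM (π₁.iso.isoM.symm m.1))) : unitSubmonoid π₂.C.k π₂.C.K) : π₂.C.K) =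
    ((π₂.iso.isoM.symm m.1 : unitSubmonoid π₂.C.k π₂.C.K) : π₂.C.K)
  rw [MulEquiv.apply_symm_apply]

end Canonical

end TCGPresentation

end GaloisMonoidPair

end Literature.AnabelianGeometry.AbsoluteAnabelian

end
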